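import Summits.BirchSwinnertonDyer.BirchSwinnertonDyer.Theorems.ByReductionTypeAtTwoP412KernelOfFacts
import Summits.BirchSwinnertonDyer.BirchSwinnertonDyer.Theorems.ByReductionTypeAtTwoMultTransportP49KernelNoPT
import Literature.NumberTheory.GaloisCohomology.RestrictedRamificationFiniteCohomologyBaseChange
import Literature.NumberTheory.IwasawaTheory.Greenberg2006.CohomologyCofiniteGenerationDischarged
import HarnessLib

/-!
# P412 in the kernel, VIII — GREENBERG'S PROPOSITION 4.12 OVER `ℚ` (all `p`) FROM FOUR NAMED PRINTED FACTS:
# the two Poitou–Tate binders (Harari Thm. 17.13 (a), (b)) are no longer inputs — NSW (8.3.20) / Harari Cor. 17.17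
# and Greenberg 2006 Prop. 3.2 are theorems of the tree

Cell `bsd-2adic` (run/shared/lean/pub/bsd-2adic/), seat `bsd-2adic-t42` GEN 26 (memo `t42/DESIGN-T42-ADDENDUM-29` §A29.4 =
audit-2's hTateEPC ADDENDUM-1 recipe, executed and sharpened). HONEST FRAMING: research route; THEOREMS ONLY (no `def`, no
named fact, no instance, no `sorry`; no new mathematics — the carrying theorems of files V / VI / VII re-landed with ONE
term swapped each); nothing booked; BSD is not proved by any of this. PARTITION: K4 (TP2 `SignedControlAtTwo` doors,
`ResidualThetaTransportAtTwoRlf…`, `SignedLowerHalvesSharpFlat…OfGreenberg`, CM rank-zero doors; ss ♭-road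
`…SupersingularFlatDivAmbient`) PRINT binder P412 = `Greenberg1999.prop412_noFiniteSubmodule_H1Sigma_of_rank_one` × all p —
reduces-the-named-input-of; bears_on K4 19097 (`--supports stmt-BirchSwinnertonDyer-19097`).

## What changes and why

File VII (`…P412KernelOfFacts`, GEN 20) proved `prop412_noFiniteSubmodule_H1Sigma_of_rank_one` from SIX printed facts
{Greenberg 2006 Prop. 5.2, Prop. 6.3, Thm. 1 (i); Harari Thm. 17.13 (b), (a); Tate's global Euler characteristic
(Milne I Thm. 5.1)}. On this road the two Poitou–Tate facts `hPTb : poitouTate_shaRestricted_tateDual ℚ` /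
`hPTa : poitouTate_restricted_three_le ℚ` were used for ONE purpose only — the FINITENESS of `Hʳ(G_{ℚ,S}, M)` for finite
`M` (NSW (8.3.20) / Harari Cor. 17.17), as `finite_restrictedCohomology_of_poitouTate hPTb hPTa` (file V :382, the base
of the corank count) and through Greenberg 2006 Prop. 3.2 `prop32_of_poitouTate_at hPTb hPTa` (file VI :315/:316/:323,
file VII :146, and XLIII's `twist_surjective_of_kernelInputs`). Both are now theorems of the tree at EVERY number field,
real places allowed: `GaloisCohomology.finite_restrictedCohomology_holds` (cell `bsd-eis`; base change to the totally
complex cyclotomic layer) and `Greenberg2006.prop32_at`. Unlike the P49 road (file LVIII, where Harari 17.13 (b) survives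
as the Ш-duality at `E[p^k](χ_u)`), the P412 road obtains LEO from the CORANK COUNT and never uses the Ш-duality. Hence:

* §1 `euler_characterModule_H_le_noPT` — the base `rank H⁰^∨ − rank H¹^∨ + rank H²^∨ ≤ −1` over `ℤ_p` for `E[p^∞]` over
  `G_{ℚ,S}`, GRANTED Tate I.5.1 alone (= file V's `euler_characterModule_H_le`);
* §2 `euler_characterModule_H_bigRep_le_noPT` — the same over `Λ` for `𝒜 = E[p^∞] ⊗ Λ^*(κ̄⁻¹)` (= file VI's
  `euler_characterModule_H_bigRep_le`);
* §3 **`prop412_noFiniteSubmodule_H1Sigma_of_four_facts`** —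
  `prop52_localH2_torsionBy_injective → prop63_shaAway_smul_surjective → thm1_sha2_isCoreflexive →
   tateGlobalEulerPoincareCharacteristic ℚ → prop412_noFiniteSubmodule_H1Sigma_of_rank_one` (= file VII's
  `prop412_noFiniteSubmodule_H1Sigma_of_facts` with file LVII's `twist_surjective_of_kernelInputs_noPT`). Trust base of
  P412: PRINT⁴ {Greenberg 2006 Prop. 5.2, Prop. 6.3, Thm. 1 (i); Milne I Thm. 5.1} + kernel (was PRINT⁶). Every
  `(h412 : prop412_noFiniteSubmodule_H1Sigma_of_rank_one)` consumer may feed it by name with two binders fewer.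

References: [GreenbergLNM1716] §4 Props. 4.9–4.12, pp. 112–119; [Greenberg2006] Thm. 1, Props. 2.4, 3.2, 4.1, 5.2, 6.3;
[Greenberg2016Selmer] Prop. 2.6.1; [MilneADT2006] I Thm. 5.1, Cor. 4.15; [NeukirchSchmidtWingberg2008] (8.3.20);
[Harari2020] Cor. 17.17.
-/

set_option autoImplicit false
set_option linter.dupNamespace false

noncomputable section

open scoped Classical

namespace Summit.BirchSwinnertonDyer.BirchSwinnertonDyer.Theorems.P412Kernel

open NumberField IsDedekindDomain Field WeierstrassCurve
  Literature.NumberTheory.EllipticCurves Literature.NumberTheory.EllipticCurves.BigRepModule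
  Literature.NumberTheory.EllipticCurves.BigGaloisRep
  Literature.NumberTheory.EllipticCurves.Greenberg1999 Literature.NumberTheory.EllipticCurves.GreenbergVatsal2000
  Literature.NumberTheory.GaloisRepresentations Literature.NumberTheory.GaloisCohomology
  Literature.NumberTheory.IwasawaTheory.Greenberg2006 Literature.NumberTheory.IwasawaTheory.Greenberg2016
  _root_.Module Submodule
  Summit.BirchSwinnertonDyer.BirchSwinnertonDyer.Theorems.SignedBaseChangeAcDivCofree
  Summit.BirchSwinnertonDyer.BirchSwinnertonDyer.Theorems.SignedBaseChangeAcDivCurveModel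
  Summit.BirchSwinnertonDyer.BirchSwinnertonDyer.Theorems.P49Kernel

/-! ## §1. The base of the corank count over `ℚ`, granted Tate I.5.1 alone -/

section Count

variable {p : ℕ} [Fact p.Prime] (W : WeierstrassCurve ℚ) [W.IsElliptic] {S : Set (HeightOneSpectrum (𝓞 ℚ))}
  [ContinuousSMul ℤ_[p] (PrimaryTorsion W.geomPoints p)]
  (ρ₀ : ContinuousRep (GaloisGroupUnramifiedOutside ℚ S) ℤ_[p] (PrimaryTorsion W.geomPoints p))

/-- **THE BASE OF THE CORANK COUNT OVER `ℚ`, all `p`, granted Tate's global Euler characteristic ALONE: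
`rank_{ℤ_p} H⁰(G_{ℚ,S}, E[p^∞])^∨ − rank_{ℤ_p} H¹(…)^∨ + rank_{ℤ_p} H²(…)^∨ ≤ −1`** — Greenberg LNM 1716 p. 114 («`−δ pⁿ` is
the Euler characteristic for the `Gal(F_Σ/F_n)`-module `E[p^∞]`», `F = ℚ`, `n = 0`, `δ = 1`; the inequality half), for
every finite `S ⊇ {v ∣ p}`, every elliptic `W/ℚ` and every continuous `ℤ_p`-model `ρ₀` of `E[p^∞]` over `G_{ℚ,S}` with
`ρ₀(σ̄)P = σP`, whenever the three duals are finitely generated. = file V's `euler_characterModule_H_le` with the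
finiteness of `Hⁱ(G_S, E[p^k])` (NSW (8.3.20) / Harari Cor. 17.17) supplied by the tree theorem
`GaloisCohomology.finite_restrictedCohomology_holds ℚ` instead of `finite_restrictedCohomology_of_poitouTate hPTb hPTa`.
[cite: GreenbergLNM1716, §4 p. 114] [cite: MilneADT2006, I Thm. 5.1, Cor. 4.15] [cite: NeukirchSchmidtWingberg2008, (8.3.20)] -/
theorem euler_characterModule_H_le_noPT
    (hTate : tateGlobalEulerPoincareCharacteristic ℚ)
    (hS : S.Finite) (hSp : ∀ v : HeightOneSpectrum (𝓞 ℚ), ((p : ℕ) : 𝓞 ℚ) ∈ v.asIdeal → v ∈ S)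
    (hρ₀ : ∀ (σ : absoluteGaloisGroup ℚ) (P : PrimaryTorsion W.geomPoints p), ρ₀ (toUnramifiedQuot ℚ S σ) P = σ • P)
    [Module.Finite ℤ_[p] (CharacterModule (ρ₀.H 0))] [Module.Finite ℤ_[p] (CharacterModule (ρ₀.H 1))]
    [Module.Finite ℤ_[p] (CharacterModule (ρ₀.H 2))] :
    (Module.finrank ℤ_[p] (CharacterModule (ρ₀.H 0)) : ℤ) - Module.finrank ℤ_[p] (CharacterModule (ρ₀.H 1)) +
        Module.finrank ℤ_[p] (CharacterModule (ρ₀.H 2)) ≤ -1 := by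
  have hprim := exists_pow_nsmul_H_primaryTorsion_eq_zero W ρ₀
  obtain ⟨hf0, hf1, hf2, key⟩ := zpCorank_H_add_le W ρ₀ hTate (finite_restrictedCohomology_holds ℚ)
    hS hSp hρ₀
  haveI := hf0; haveI := hf1; haveI := hf2
  rw [ZpCorank.finrank_eq_zpCorank_of_addEquiv_characterModule p (hprim 0) (AddEquiv.refl _),
    ZpCorank.finrank_eq_zpCorank_of_addEquiv_characterModule p (hprim 1) (AddEquiv.refl _),
    ZpCorank.finrank_eq_zpCorank_of_addEquiv_characterModule p (hprim 2) (AddEquiv.refl _)]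
  omega

end Count

/-! ## §2. The corank count for `𝒜 = E[p^∞] ⊗ Λ^*` over `ℚ`, granted Tate I.5.1 alone -/

section Euler

variable {p : ℕ} [Fact p.Prime]

/-- **`rank_Λ H⁰(G_{ℚ,S}, 𝒜)^∨ − rank_Λ H¹(G_{ℚ,S}, 𝒜)^∨ + rank_Λ H²(G_{ℚ,S}, 𝒜)^∨ ≤ −1`** for the co-induced module
`𝒜 = E[p^∞] ⊗ Λ^*(κ̄⁻¹)` (`bigRep`) of ANY continuous `ℤ_p`-model `ρ₀` of `E[p^∞]` over `G_{ℚ,S}` with `ρ₀(σ̄)P = σP`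
(`S ⊇ {v ∣ p}` finite), GRANTED Tate I.5.1 alone — Greenberg's «`corank_Λ H¹ ≥ corank_Λ H² + δ`» half (LNM 1716 p. 114):
STEP at `T = θ₁` (`alternatingSum_finrank_characterModule_H_le`), the transport of file VI §3, and the BASE §1. = file VI's
`euler_characterModule_H_bigRep_le` with Greenberg 2006 Prop. 3.2 by the tree theorem `Greenberg2006.prop32_at`.
[cite: GreenbergLNM1716, §4 pp. 114–115] [cite: Greenberg2006, §4 A p. 368, Prop. 3.2] [cite: MilneADT2006, I Thm. 5.1]
[cite: NeukirchSchmidtWingberg2008, (8.3.20)] -/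
theorem euler_characterModule_H_bigRep_le_noPT
    (hTate : tateGlobalEulerPoincareCharacteristic ℚ)
    (W : WeierstrassCurve ℚ) [W.IsElliptic] (κ : ZpExtension ℚ p)
    {S : Set (HeightOneSpectrum (𝓞 ℚ))} (hS : S.Finite)
    (hSp : ∀ v : HeightOneSpectrum (𝓞 ℚ), ((p : ℕ) : 𝓞 ℚ) ∈ v.asIdeal → v ∈ S)
    [TopologicalSpace (IwasawaAlgebra p)] [DiscreteTopology (IwasawaAlgebra p)] [IsTopologicalRing (IwasawaAlgebra p)]
    (ρ₀ : ContinuousRep (GaloisGroupUnramifiedOutside ℚ S) ℤ_[p] (PrimaryTorsion W.geomPoints p))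
    (hρ₀ : ∀ (σ : absoluteGaloisGroup ℚ) (P : PrimaryTorsion W.geomPoints p),
      ρ₀ (toUnramifiedQuot ℚ S σ) P = σ • P)
    [Module.Finite (IwasawaAlgebra p) (CharacterModule ((bigRep (κ.liftUnramifiedOutside S hSp) ρ₀).H 0))]
    [Module.Finite (IwasawaAlgebra p) (CharacterModule ((bigRep (κ.liftUnramifiedOutside S hSp) ρ₀).H 1))]
    [Module.Finite (IwasawaAlgebra p) (CharacterModule ((bigRep (κ.liftUnramifiedOutside S hSp) ρ₀).H 2))] :
    (Module.finrank (IwasawaAlgebra p) (CharacterModule ((bigRep (κ.liftUnramifiedOutside S hSp) ρ₀).H 0)) : ℤ) -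
        Module.finrank (IwasawaAlgebra p) (CharacterModule ((bigRep (κ.liftUnramifiedOutside S hSp) ρ₀).H 1)) +
        Module.finrank (IwasawaAlgebra p) (CharacterModule ((bigRep (κ.liftUnramifiedOutside S hSp) ρ₀).H 2)) ≤ -1 := by
  haveI : ContinuousSMul ℤ_[p] (PrimaryTorsion W.geomPoints p) := PrimaryTorsion.continuousSMul
  set θ : IwasawaAlgebra p :=
    PowerSeries.C (((1 : ℤ) : ℤ_[p])) * PowerSeries.X + PowerSeries.C ((((1 : ℤ) : ℤ_[p])) - 1) with hθ
  have hθX : θ = PowerSeries.X := twistOne_eq_X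
  have hθ0 : θ ≠ 0 := by rw [hθX]; exact PowerSeries.X_ne_zero
  have hθprime : (Ideal.span {θ}).IsPrime := by rw [hθX]; exact PowerSeries.span_X_isPrime
  let 𝒜 := bigRep (κ.liftUnramifiedOutside S hSp) ρ₀
  let σA := 𝒜.subrepresentation (torsionBy (IwasawaAlgebra p) _ θ) (𝒜.torsionBy_smul_le_comap θ)
  -- `0 → 𝒜[θ] → 𝒜 →θ 𝒜 → 0`
  obtain ⟨ι, μ, hSES, hμ⟩ := exists_isSES_torsionBy_smul 𝒜 θ
    (P49Kernel.twist_smul_surjective p W (dvd_one_sub_one (p := p)))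
  have hA : ∀ a : torsionBy (IwasawaAlgebra p) (BigRepModule ℤ_[p] p (PrimaryTorsion W.geomPoints p)) θ,
      θ • a = 0 := fun a ↦ Subtype.ext ((mem_torsionBy_iff θ _).mp a.2)
  -- finite generation of all duals (Greenberg 2006 Prop. 3.2 — tree theorem `prop32_at`)
  obtain ⟨e⟩ := P49Kernel.nonempty_ringEquiv_mvPowerSeries_fin_one p
  have hcof := (prop32_at _ hS hSp e 𝒜 (P49Kernel.isCofinitelyGenerated_bigRepModule p W)).1
  have hcofA := (prop32_at _ hS hSp e σA
    ((P49Kernel.isCofinitelyGenerated_bigRepModule p W).submodule _)).1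
  have hfin : ∀ n, Module.Finite (IwasawaAlgebra p) (CharacterModule (𝒜.H n)) := fun n ↦
    isCofinitelyGenerated_iff_module_finite_characterModule.mp (hcof n)
  have hfinA : ∀ n, Module.Finite (IwasawaAlgebra p) (CharacterModule (σA.H n)) := fun n ↦
    isCofinitelyGenerated_iff_module_finite_characterModule.mp (hcofA n)
  let e0 : ℤ_[p] ≃+* MvPowerSeries (Fin 0) ℤ_[p] := (NearlyOrdinaryPresentationCA.mvPowerSeriesFinZeroEquiv ℤ_[p]).symm
  have hcof0 := (prop32_at _ hS hSp e0 ρ₀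
    (IsCofree.isCofinitelyGenerated (isCofree_primaryTorsion W p))).1
  haveI h0 : Module.Finite ℤ_[p] (CharacterModule (ρ₀.H 0)) :=
    isCofinitelyGenerated_iff_module_finite_characterModule.mp (hcof0 0)
  haveI h1 : Module.Finite ℤ_[p] (CharacterModule (ρ₀.H 1)) :=
    isCofinitelyGenerated_iff_module_finite_characterModule.mp (hcof0 1)
  haveI h2 : Module.Finite ℤ_[p] (CharacterModule (ρ₀.H 2)) :=
    isCofinitelyGenerated_iff_module_finite_characterModule.mp (hcof0 2)
  have hfinT : ∀ n, Module.Finite (IwasawaAlgebra p ⧸ Ideal.span {θ})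
      (torsionBy (IwasawaAlgebra p) (CharacterModule (σA.H n)) θ) := fun n ↦ by
    haveI := hfinA n
    haveI : Module.Finite (IwasawaAlgebra p) (torsionBy (IwasawaAlgebra p) (CharacterModule (σA.H n)) θ) :=
      Module.Finite.of_injective _ (torsionBy (IwasawaAlgebra p) (CharacterModule (σA.H n)) θ).injective_subtype
    exact Module.Finite.of_restrictScalars_finite (IwasawaAlgebra p) _ _
  haveI := hfinT 0
  haveI := hfinT 1
  haveI := hfinT 2
  -- STEP, transport, BASE
  have hstep := alternatingSum_finrank_characterModule_H_le hθ0 hθprime σA 𝒜 hSES hμ hA hfin hfinA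
  have ht0 := finrank_torsionBy_characterModule_H_twistOne_eq W κ ρ₀ hSp 0
  have ht1 := finrank_torsionBy_characterModule_H_twistOne_eq W κ ρ₀ hSp 1
  have ht2 := finrank_torsionBy_characterModule_H_twistOne_eq W κ ρ₀ hSp 2
  have hbase := euler_characterModule_H_le_noPT W ρ₀ hTate hS hSp hρ₀
  rw [ht0, ht1, ht2] at hstep
  exact le_trans hstep hbase

end Euler

/-! ## §3. Proposition 4.12 over `ℚ` from four named facts -/

section Assembly

/-- A finite place above `p` (lying-over for `ℤ ⊆ 𝓞 K`; verbatim from file VII). [folklore] -/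
private theorem exists_place_natCast_mem' {K : Type} [Field K] [NumberField K] (p : ℕ) [Fact p.Prime] :
    ∃ v : HeightOneSpectrum (𝓞 K), ((p : ℕ) : 𝓞 K) ∈ v.asIdeal := by
  have hp : p.Prime := Fact.out
  have hp' : Prime (p : ℤ) := Nat.prime_iff_prime_int.mp hp
  haveI : (Ideal.span {(p : ℤ)}).IsPrime := (Ideal.span_singleton_prime hp'.ne_zero).mpr hp'
  have hinj : Function.Injective (algebraMap ℤ (𝓞 K)) := (algebraMap ℤ (𝓞 K)).injective_int
  obtain ⟨Q, -, hQ, hQp⟩ := Ideal.exists_ideal_over_prime_of_isIntegral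
    (S := 𝓞 K) (Ideal.span {(p : ℤ)}) ⊥
    (by
      rw [← RingHom.ker_eq_comap_bot, (RingHom.injective_iff_ker_eq_bot _).mp hinj]
      exact bot_le)
  have hmem : (p : ℤ) ∈ Q.comap (algebraMap ℤ (𝓞 K)) := by
    rw [hQp]
    exact Ideal.mem_span_singleton_self _
  have hQne : Q ≠ ⊥ := by
    intro hQbot
    rw [hQbot, Ideal.mem_comap, Ideal.mem_bot] at hmem
    exact hp'.ne_zero (hinj (by rw [hmem, map_zero]))
  refine ⟨⟨Q, hQ, hQne⟩, ?_⟩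
  have := Ideal.mem_comap.mp hmem
  rwa [map_natCast] at this

/-- **GREENBERG'S PROPOSITION 4.12 OVER `ℚ` (every `p`) FROM FOUR NAMED PRINTED FACTS**: if `H¹(ℚ_Σ/ℚ_∞, E[p^∞])` has
`Λ`-corank `1` (any finitely generated Pontryagin-dual datum `Y` with `rank_Λ Y = 1`), then it has no proper `Λ`-submodule
of finite index (`Y` has no non-zero finite `Λ`-submodule) — `Greenberg1999.prop412_noFiniteSubmodule_H1Sigma_of_rank_one` —
granted Greenberg 2006 Prop. 5.2 / Prop. 6.3 / Thm. 1 (i) and Tate's global Euler characteristic for `ℚ`; everything else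
(NSW (8.3.20) = `finite_restrictedCohomology_holds`, Greenberg 2006 Prop. 3.2 = `prop32_at`, Shapiro, LOC, the corank
count with the real place at `p = 2`, LEO) is kernel. = file VII's `prop412_noFiniteSubmodule_H1Sigma_of_facts` minus the
binders `hPTb`, `hPTa` (Harari Thm. 17.13 (b), (a)). [cite: GreenbergLNM1716, Prop. 4.12 and its proof pp. 114–119]
[cite: Greenberg2006, Thm. 1, Props. 2.4, 3.2, 5.2, 6.3] [cite: Greenberg2016Selmer, Prop. 2.6.1]
[cite: MilneADT2006, I Thm. 5.1] [cite: NeukirchSchmidtWingberg2008, (8.3.20)] -/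
theorem prop412_noFiniteSubmodule_H1Sigma_of_four_facts
    (h52 : prop52_localH2_torsionBy_injective) (h63 : prop63_shaAway_smul_surjective)
    (hT1 : thm1_sha2_isCoreflexive)
    (hTate : tateGlobalEulerPoincareCharacteristic ℚ) :
    prop412_noFiniteSubmodule_H1Sigma_of_rank_one := by
  intro W _ _ p _ κ γ hκ hγ S₀ hbad Y _ _ _ dY hbij hX hC hrank N hN
  letI : TopologicalSpace (IwasawaAlgebra p) := ⊥
  haveI : DiscreteTopology (IwasawaAlgebra p) := ⟨rfl⟩
  haveI : ContinuousAdd (IwasawaAlgebra p) := ⟨continuous_of_discreteTopology⟩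
  haveI : ContinuousMul (IwasawaAlgebra p) := ⟨continuous_of_discreteTopology⟩
  haveI : ContinuousNeg (IwasawaAlgebra p) := ⟨continuous_of_discreteTopology⟩
  haveI : IsTopologicalRing (IwasawaAlgebra p) := IsTopologicalRing.mk
  -- the set `S = Σ₀ ∪ {v ∣ p}` and the descended model `ρ₀` of `E[p^∞]` over `G_{ℚ,S}`
  have hS : (((↑S₀ : Set (HeightOneSpectrum (𝓞 ℚ))) ∪
      {v : HeightOneSpectrum (𝓞 ℚ) | ((p : ℕ) : 𝓞 ℚ) ∈ v.asIdeal})).Finite :=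
    finite_union_setOf_natCast_mem p (Fact.out : p.Prime).ne_zero S₀
  have hSp := mem_union_setOf_natCast_mem (K := ℚ) p S₀
  have hSbad : ∀ w : HeightOneSpectrum (𝓞 ℚ), ¬ W.HasGoodReductionAt w →
      w ∈ ((↑S₀ : Set (HeightOneSpectrum (𝓞 ℚ))) ∪
        {v : HeightOneSpectrum (𝓞 ℚ) | ((p : ℕ) : 𝓞 ℚ) ∈ v.asIdeal}) := fun w hw ↦ by
    by_contra h
    exact hw (hbad w (fun h' ↦ h (Or.inl h')) (fun h' ↦ h (Or.inr h')))
  have hNS : ∀ n ∈ ramificationSubgroup ℚ (((↑S₀ : Set (HeightOneSpectrum (𝓞 ℚ))) ∪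
      {v : HeightOneSpectrum (𝓞 ℚ) | ((p : ℕ) : 𝓞 ℚ) ∈ v.asIdeal})),
      ∀ P : PrimaryTorsion W.geomPoints p, n • P = P := fun n hn P ↦
    smul_primaryTorsion_eq_of_mem_ramificationSubgroup W p _ hSbad hSp hn P
  obtain ⟨ρ₀, hρ₀⟩ := exists_continuousRep_primaryTorsion W p _ hNS
  obtain ⟨η, hη⟩ := exists_place_natCast_mem' (K := ℚ) p
  set 𝒜 := bigRep (κ.liftUnramifiedOutside _ hSp) ρ₀ with h𝒜
  -- (I4) the Shapiro bridge
  obtain ⟨Sh, hSh⟩ := exists_shapiro_bridge W κ γ hγ (S₀ := (↑S₀ : Set (HeightOneSpectrum (𝓞 ℚ))))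
    Set.subset_union_left hSp (fun v hv₀ hpv hv ↦ hv.elim hv₀ hpv) hNS 𝒜 (bigRep_lift_mk_apply W κ hSp ρ₀ hρ₀)
  -- cofinite generation of `Hⁱ(G_S, 𝒜)` (Greenberg 2006 Prop. 3.2 — tree theorem `prop32_at`)
  obtain ⟨e⟩ := nonempty_ringEquiv_mvPowerSeries_fin_one p
  have hcof : ∀ i : ℕ, IsCofinitelyGenerated (IwasawaAlgebra p) (𝒜.H i) :=
    (prop32_at _ hS hSp e 𝒜 (isCofinitelyGenerated_bigRepModule p W)).1
  have hfin : ∀ i : ℕ, Module.Finite (IwasawaAlgebra p) (CharacterModule (𝒜.H i)) := fun i ↦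
    isCofinitelyGenerated_iff_module_finite_characterModule.mp (hcof i)
  haveI := hfin 0
  haveI := hfin 1
  haveI := hfin 2
  -- (R1) rank transfer: `rank_Λ H¹(G_S, 𝒜)^∨ = 1`
  have hSh1 : ∀ x : 𝒜.H 1,
      ((Sh ((PowerSeries.X : IwasawaAlgebra p) • x) :
        unramifiedOutside κ.kerSubgroup (W.geomPrimaryTorsion p) p (↑S₀ : Set (HeightOneSpectrum (𝓞 ℚ)))) :
          W.subgroupH1 p κ.kerSubgroup) = W.conjH1 p κ.kerSubgroup γ (Sh x) - Sh x := fun x ↦ by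
    have h := hSh 1 x
    simp only [Int.cast_one, map_one, one_mul, sub_self, map_zero, add_zero, one_smul] at h
    exact h
  have h1 : Module.finrank (IwasawaAlgebra p) (CharacterModule (𝒜.H 1)) = 1 :=
    finrank_characterModule_H_one_eq_one W κ hγ _ 𝒜 Sh hSh1 Y dY hbij hX hC hrank
  -- the corank count (files II–VI) ⟹ `rank_Λ H²(G_S, 𝒜)^∨ = 0` ⟹ LEO
  have hE := euler_characterModule_H_bigRep_le_noPT hTate W κ hS hSp ρ₀ hρ₀
  have h2 : Module.finrank (IwasawaAlgebra p) (CharacterModule (𝒜.H 2)) = 0 := by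
    have h0 : (0 : ℤ) ≤ Module.finrank (IwasawaAlgebra p) (CharacterModule (𝒜.H 0)) := by positivity
    rw [← h𝒜] at hE
    rw [h1] at hE
    push_cast at hE
    omega
  have hLEO : LEO _ 𝒜 :=
    leo_of_exists_ne_zero_forall_smul_eq_zero _ 𝒜
      (exists_ne_zero_forall_smul_eq_zero_of_finrank_characterModule_eq_zero h2)
  -- the engine: twisted surjectivity (Greenberg 2016 Prop. 2.6.1, 2006 Thm. 1, Prop. 2.4), then Greenberg's last step
  obtain ⟨u, hu, hsurj⟩ := twist_surjective_of_kernelInputs_noPT W κ γ _ h52 h63 hT1 hS hSp 𝒜 hLEO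
    (hSp η hη) (loc1_bigRep_primaryTorsion_rat hκ hSp W ρ₀ hη) (fun v _ ↦ loc2_bigRep_primaryTorsion _ W ρ₀ v)
    Sh hSh
  exact noFiniteSubmodule_dualH1Sigma_of_twist_surjective W p κ.kerSubgroup κ.isClosed_kerSubgroup γ
    _ hu hsurj Y dY hbij.1 hX hC N hN

end Assembly

end Summit.BirchSwinnertonDyer.BirchSwinnertonDyer.Theorems.P412Kernel

end
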